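import Mathlib
import HarnessLib
import Summits.ResolutionOfSingularities.ResolutionOfSingularities.Theorems.WildQuotientsWildQuotientResolutionConductorOneOneVariablePoly
import Summits.ResolutionOfSingularities.ResolutionOfSingularities.Theorems.WildQuotientsWildQuotientResolutionConductorOneAction

/-!
# S2 F5a (localised half): the one-variable lemma on `k[s][u⁻¹]`, `u = 1 − s^{p−1}`
(crux stmt-ResolutionOfSingularities-15640 `WildQuotients.WildQuotientResolution`, line `Sketch`;
chain w45c post-V5 programme S2, design `L/res-L1-w45c-lead-1/S2-DESIGN.md` v1.1 §7 (7.7) F5,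
res-L1-w45c-plan-1 RULING 2026-08-27T17:07:17Z (R4). [OURS · L1 W4.5c] — NOT a statement of the
manuscript. Lead prover res-L1-w45c-lead-1.)

`R₁ := k[X][(1 − X^{p−1})⁻¹]` (`ConductorOne.OneVarRing k p`), `s` the image of `X`, `u = 1 − s^{p−1}`
(a unit, inverse `v`), `1 + s` a unit (it divides `u`). For ANY `k`-algebra endomorphism `σ₁` of `R₁`
with the conductor-𝟙 law `σ₁ s · (1+s) = s` (`σ₁ s = s/(1+s)`; then `σ₁ u = u/(1+s)^p`,
`σ₁ v = v (1+s)^p`):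

* `ConductorOne.oneVar_exists_sum_of_twist` — if `σ₁ f = (1+s)^N f` (`N : ℕ`) then
  `f = ∑_{d ≤ D} q_d · s^{pm−N−pd} v^{m−d}` for some `m ≥ D` with `N + pD ≤ pm` (write `f = P(s)/u^m`,
  clear denominators into `Φ_{pm}(P) = (1+X)^N P` in `k[X]`, apply the polynomial normal form
  `ConductorOne.exists_normalForm_of_twistSubst_eq`);
* **`ConductorOne.oneVar_mem_span_of_twist`** — the two-sided form: `(1+s)^a σ₁ f = (1+s)^b f` ⇒
  `f ∈ span_k { s^{pd+a−b} · u^{−d} : d ∈ ℤ, b ≤ pd + a }` (reduce to the first by `f ↦ v^j f`).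

This is the graded piece of CLAIM P (design (7.7)): on the `(m_K, m_J)`-piece of the straightened
chart ring the invariance condition is exactly the twist condition with `b − a = |m_K| − |m_J|`.
-/

-- single-problem summit: the doubled namespace component `ResolutionOfSingularities` is forced
set_option linter.dupNamespace false

noncomputable section

open Polynomial

namespace Summit.ResolutionOfSingularities.ResolutionOfSingularities.Theorems.WildQuotientResolution.ConductorOne

variable (k : Type) [Field k] (p : ℕ)

/-- The one-variable ring `R₁ = k[X][(1 − X^{p−1})⁻¹]`. [OURS · L1 W4.5c] -/
abbrev OneVarRing : Type := Localization.Away (1 - X ^ (p - 1) : k[X])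

/-- The coordinate `s` of `R₁`. [OURS · L1 W4.5c] -/
abbrev oneVarS : OneVarRing k p := algebraMap k[X] (OneVarRing k p) X

/-- `1 − X^{p−1}` is a non-zero-divisor of `k[X]`. [folklore] -/
theorem one_sub_X_pow_mem_nonZeroDivisors [Fact p.Prime] : (1 - X ^ (p - 1) : k[X]) ∈ nonZeroDivisors k[X] := by
  apply mem_nonZeroDivisors_of_ne_zero
  intro h
  have h1 := congrArg (Polynomial.eval (0 : k)) h
  have hp : p - 1 ≠ 0 := by have := (Fact.out : p.Prime).two_le; omega
  rw [eval_sub, eval_one, eval_pow, eval_X, zero_pow hp, sub_zero, eval_zero] at h1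
  exact one_ne_zero h1

/-- `k[X] → R₁` is injective. [OURS · L1 W4.5c] -/
theorem oneVar_algebraMap_injective [Fact p.Prime] :
    Function.Injective (algebraMap k[X] (OneVarRing k p)) :=
  IsLocalization.injective (OneVarRing k p)
    (powers_le_nonZeroDivisors_of_noZeroDivisors (nonZeroDivisors.ne_zero
      (one_sub_X_pow_mem_nonZeroDivisors k p)))

/-- `R₁` is a domain. [OURS · L1 W4.5c] -/
theorem oneVar_isDomain [Fact p.Prime] : IsDomain (OneVarRing k p) :=
  IsLocalization.isDomain_localization
    (powers_le_nonZeroDivisors_of_noZeroDivisors (nonZeroDivisors.ne_zero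
      (one_sub_X_pow_mem_nonZeroDivisors k p)))

/-- `algebraMap k[X] R₁ (C c) = algebraMap k R₁ c`. [folklore] -/
theorem oneVar_algebraMap_C (c : k) :
    algebraMap k[X] (OneVarRing k p) (C c) = algebraMap k (OneVarRing k p) c := by
  rw [← Polynomial.algebraMap_eq]
  exact (IsScalarTower.algebraMap_apply k k[X] (OneVarRing k p) c).symm

/-- `u = 1 − s^{p−1}` is a unit of `R₁`. [OURS · L1 W4.5c] -/
theorem oneVar_isUnit_u : IsUnit (1 - oneVarS k p ^ (p - 1)) := by
  have h := IsLocalization.Away.algebraMap_isUnit (S := OneVarRing k p) (1 - X ^ (p - 1) : k[X])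
  simpa only [map_sub, map_one, map_pow] using h

/-- `1 + s` is a unit of `R₁` (it divides `u` by the norm identity). [OURS · L1 W4.5c] -/
theorem oneVar_isUnit_one_add_s [Fact p.Prime] [CharP k p] : IsUnit (1 + oneVarS k p) := by
  haveI := oneVar_isDomain k p
  haveI : CharP (OneVarRing k p) p :=
    charP_of_injective_algebraMap (algebraMap k (OneVarRing k p)).injective p
  refine isUnit_of_dvd_unit ?_ (oneVar_isUnit_u k p)
  exact ⟨(1 + oneVarS k p) ^ (p - 1) - oneVarS k p ^ (p - 1), by
    rw [mul_comm]; exact (norm_identity p (oneVarS k p)).symm⟩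

/-- `algebraMap k[X] R₁ P = aeval s P`. [folklore] -/
theorem oneVar_algebraMap_eq_aeval (P : k[X]) :
    algebraMap k[X] (OneVarRing k p) P = aeval (oneVarS k p) P := by
  have h := Polynomial.aeval_algHom_apply (IsScalarTower.toAlgHom k k[X] (OneVarRing k p)) X P
  rw [aeval_X_left_apply, IsScalarTower.toAlgHom_apply] at h
  exact h.symm

section Law

variable [Fact p.Prime] [CharP k p]
variable (σ₁ : OneVarRing k p →ₐ[k] OneVarRing k p) (hσ : σ₁ (oneVarS k p) * (1 + oneVarS k p) = oneVarS k p)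
include hσ

/-- `σ₁ s = s · w₁` for the inverse `w₁` of `1 + s`. [OURS · L1 W4.5c] -/
theorem oneVar_sigma_s :
    σ₁ (oneVarS k p) = oneVarS k p * ↑((oneVar_isUnit_one_add_s k p).unit⁻¹) := by
  have hw := (oneVar_isUnit_one_add_s k p).val_inv_mul
  set w := (↑((oneVar_isUnit_one_add_s k p).unit⁻¹) : OneVarRing k p)
  calc σ₁ (oneVarS k p) = σ₁ (oneVarS k p) * ((1 + oneVarS k p) * w) := by
        rw [mul_comm (1 + oneVarS k p) w, hw, mul_one]
    _ = oneVarS k p * w := by rw [← mul_assoc, hσ]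

omit [Fact p.Prime] [CharP k p] hσ in
/-- `σ₁ (P(s)) = P(σ₁ s)`. [OURS · L1 W4.5c] -/
theorem oneVar_sigma_algebraMap (P : k[X]) :
    σ₁ (algebraMap k[X] (OneVarRing k p) P) = aeval (σ₁ (oneVarS k p)) P := by
  rw [oneVar_algebraMap_eq_aeval, ← Polynomial.aeval_algHom_apply]

/-- **The twisted substitution identity**: `(1+s)^D · σ₁(P(s)) = Φ_D(P)(s)` for `natDegree P ≤ D`.
[OURS · L1 W4.5c] -/
theorem oneVar_sigma_algebraMap_mul_pow (P : k[X]) (D : ℕ) (hP : P.natDegree ≤ D) :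
    (1 + oneVarS k p) ^ D * σ₁ (algebraMap k[X] (OneVarRing k p) P) =
      algebraMap k[X] (OneVarRing k p) (twistSubst D P) := by
  rw [oneVar_sigma_algebraMap k p σ₁ P, oneVar_sigma_s k p σ₁ hσ]
  have hws : (↑((oneVar_isUnit_one_add_s k p).unit⁻¹) : OneVarRing k p) * (1 + oneVarS k p) = 1 :=
    (oneVar_isUnit_one_add_s k p).val_inv_mul
  generalize hw : (↑((oneVar_isUnit_one_add_s k p).unit⁻¹) : OneVarRing k p) = w at hws ⊢
  set s := oneVarS k p with hs
  -- expand both sides as sums over `i ≤ D`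
  conv_lhs => rw [P.as_sum_range' (D + 1) (Nat.lt_succ_of_le hP)]
  rw [map_sum, Finset.mul_sum, twistSubst, map_sum]
  refine Finset.sum_congr rfl fun i hi => ?_
  have hi' : i ≤ D := Nat.lt_succ_iff.mp (Finset.mem_range.mp hi)
  rw [aeval_monomial, map_mul, map_mul, map_pow, map_pow, map_add, map_one, oneVar_algebraMap_C]
  -- `(1+s)^D (s w)^i = s^i (1+s)^{D-i}`
  have hpow : (1 + s) ^ D * (s * w) ^ i = s ^ i * (1 + s) ^ (D - i) := by
    have hD : D = (D - i) + i := by omega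
    rw [mul_pow, hD, pow_add, Nat.add_sub_cancel]
    have : (1 + s) ^ i * w ^ i = 1 := by rw [← mul_pow, mul_comm, hws, one_pow]
    calc (1 + s) ^ (D - i) * (1 + s) ^ i * (s ^ i * w ^ i)
        = (1 + s) ^ (D - i) * s ^ i * ((1 + s) ^ i * w ^ i) := by ring
      _ = s ^ i * (1 + s) ^ (D - i) := by rw [this]; ring
  calc (1 + s) ^ D * ((algebraMap k (OneVarRing k p)) (P.coeff i) * (s * w) ^ i)
      = (algebraMap k (OneVarRing k p)) (P.coeff i) * ((1 + s) ^ D * (s * w) ^ i) := by ring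
    _ = (algebraMap k (OneVarRing k p)) (P.coeff i) * s ^ i * (1 + s) ^ (D - i) := by
        rw [hpow]; ring

/-- `σ₁ u = u · w₁^p` (norm identity). [OURS · L1 W4.5c] -/
theorem oneVar_sigma_u :
    σ₁ (1 - oneVarS k p ^ (p - 1)) =
      (1 - oneVarS k p ^ (p - 1)) * ↑((oneVar_isUnit_one_add_s k p).unit⁻¹) ^ p := by
  haveI := oneVar_isDomain k p
  haveI : CharP (OneVarRing k p) p :=
    charP_of_injective_algebraMap (algebraMap k (OneVarRing k p)).injective p
  rw [map_sub, map_one, map_pow, oneVar_sigma_s k p σ₁ hσ, mul_pow]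
  have hws : (↑((oneVar_isUnit_one_add_s k p).unit⁻¹) : OneVarRing k p) * (1 + oneVarS k p) = 1 :=
    (oneVar_isUnit_one_add_s k p).val_inv_mul
  generalize hw : (↑((oneVar_isUnit_one_add_s k p).unit⁻¹) : OneVarRing k p) = w at hws ⊢
  set s := oneVarS k p with hs
  have hp : p - 1 + 1 = p := Nat.sub_add_cancel (Fact.out : p.Prime).one_le
  have hL1 := norm_identity p s
  -- `1 − s^{p−1} w^{p−1} = ((1+s)^{p−1} − s^{p−1}) w^{p−1}` and `(1+s)^{p-1} - s^{p-1} = u w`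
  have h1 : (1 + s) ^ (p - 1) * w ^ (p - 1) = 1 := by rw [← mul_pow, mul_comm, hws, one_pow]
  have h2 : (1 + s) ^ (p - 1) - s ^ (p - 1) = (1 - s ^ (p - 1)) * w := by
    calc (1 + s) ^ (p - 1) - s ^ (p - 1)
        = ((1 + s) ^ (p - 1) - s ^ (p - 1)) * (w * (1 + s)) := by rw [hws, mul_one]
      _ = (((1 + s) ^ (p - 1) - s ^ (p - 1)) * (1 + s)) * w := by ring
      _ = (1 - s ^ (p - 1)) * w := by rw [hL1]
  calc 1 - s ^ (p - 1) * w ^ (p - 1)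
      = (1 + s) ^ (p - 1) * w ^ (p - 1) - s ^ (p - 1) * w ^ (p - 1) := by rw [h1]
    _ = ((1 + s) ^ (p - 1) - s ^ (p - 1)) * w ^ (p - 1) := by ring
    _ = (1 - s ^ (p - 1)) * w * w ^ (p - 1) := by rw [h2]
    _ = (1 - s ^ (p - 1)) * w ^ p := by rw [mul_assoc, ← pow_succ', hp]

/-- `σ₁ v = v · (1+s)^p` for the inverse `v` of `u`. [OURS · L1 W4.5c] -/
theorem oneVar_sigma_v :
    σ₁ ↑((oneVar_isUnit_u k p).unit⁻¹) =
      ↑((oneVar_isUnit_u k p).unit⁻¹) * (1 + oneVarS k p) ^ p := by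
  set s := oneVarS k p with hs
  set u := 1 - oneVarS k p ^ (p - 1) with hu
  set v := (↑((oneVar_isUnit_u k p).unit⁻¹) : OneVarRing k p) with hv
  set w := (↑((oneVar_isUnit_one_add_s k p).unit⁻¹) : OneVarRing k p) with hw
  have huv : u * v = 1 := (oneVar_isUnit_u k p).mul_val_inv
  have hws : w * (1 + s) = 1 := (oneVar_isUnit_one_add_s k p).val_inv_mul
  have hσu : σ₁ u = u * w ^ p := oneVar_sigma_u k p σ₁ hσ
  -- `σ₁ u * σ₁ v = 1`
  have h1 : σ₁ u * σ₁ v = 1 := by rw [← map_mul, huv, map_one]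
  rw [hσu] at h1
  -- multiply `u w^p σ₁ v = 1` by `v (1+s)^p`
  have h2 : w ^ p * (1 + s) ^ p = 1 := by rw [← mul_pow, hws, one_pow]
  calc σ₁ v = σ₁ v * ((u * v) * (w ^ p * (1 + s) ^ p)) := by rw [huv, h2, mul_one, mul_one]
    _ = (u * w ^ p * σ₁ v) * (v * (1 + s) ^ p) := by ring
    _ = v * (1 + s) ^ p := by rw [h1, one_mul]

/-- **Normal form of a twisted element** (`N : ℕ`): if `σ₁ f = (1+s)^N · f` then
`f = ∑_{d ≤ D} q_d · s^{pm−N−pd} · v^{m−d}` with `N + p·D ≤ p·m` and `D ≤ m`. [OURS · L1 W4.5c] -/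
theorem oneVar_exists_sum_of_twist (N : ℕ) (f : OneVarRing k p)
    (hf : σ₁ f = (1 + oneVarS k p) ^ N * f) :
    ∃ (m D : ℕ) (q : ℕ → k), N + p * D ≤ p * m ∧ D ≤ m ∧
      f = ∑ d ∈ Finset.range (D + 1),
        q d • (oneVarS k p ^ (p * m - N - p * d) * ↑((oneVar_isUnit_u k p).unit⁻¹) ^ (m - d)) := by
  classical
  set s := oneVarS k p with hs
  set u := 1 - oneVarS k p ^ (p - 1) with hu
  set v := (↑((oneVar_isUnit_u k p).unit⁻¹) : OneVarRing k p) with hv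
  set w := (↑((oneVar_isUnit_one_add_s k p).unit⁻¹) : OneVarRing k p) with hw
  have huv : u * v = 1 := (oneVar_isUnit_u k p).mul_val_inv
  have hws : w * (1 + s) = 1 := (oneVar_isUnit_one_add_s k p).val_inv_mul
  have hp1 : 1 ≤ p := (Fact.out : p.Prime).one_le
  have hualg : algebraMap k[X] (OneVarRing k p) (1 - X ^ (p - 1)) = u := by
    rw [map_sub, map_one, map_pow]
  -- `f * u^m₀ = P₀(s)`
  obtain ⟨⟨P₀, ⟨_, ⟨m₀, rfl⟩⟩⟩, hP₀⟩ :=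
    IsLocalization.surj (Submonoid.powers (1 - X ^ (p - 1) : k[X])) f
  simp only at hP₀
  rw [map_pow, hualg] at hP₀
  -- enlarge `m`: `m := m₀ + j`, `P := P₀ * (1 - X^(p-1))^j`, `j := natDegree P₀ + N`
  set j := P₀.natDegree + N with hj
  set m := m₀ + j with hm
  set P : k[X] := P₀ * (1 - X ^ (p - 1)) ^ j with hPdef
  have hfP : f * u ^ m = algebraMap k[X] (OneVarRing k p) P := by
    rw [hPdef, map_mul, map_pow, hualg, ← hP₀, hm, pow_add, mul_assoc]
  have hudeg : ((1 : k[X]) - X ^ (p - 1)).natDegree ≤ p - 1 :=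
    (natDegree_sub_le _ _).trans (max_le (by simp) (natDegree_X_pow_le _))
  have hPdeg : P.natDegree ≤ p * m := by
    rw [hPdef]
    refine natDegree_mul_le.trans ?_
    have h2 : (((1 : k[X]) - X ^ (p - 1)) ^ j).natDegree ≤ j * (p - 1) :=
      natDegree_pow_le.trans (Nat.mul_le_mul_left j hudeg)
    have hp' : p = (p - 1) + 1 := (Nat.sub_add_cancel hp1).symm
    have key : p * j = j * (p - 1) + j := by
      conv_lhs => rw [hp']
      ring
    have h3 : P₀.natDegree + j * (p - 1) ≤ p * m := by
      have hjd : P₀.natDegree ≤ j := by rw [hj]; omega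
      calc P₀.natDegree + j * (p - 1) ≤ j * (p - 1) + j := by omega
        _ = p * j := key.symm
        _ ≤ p * m := Nat.mul_le_mul_left p (by rw [hm]; omega)
    exact (add_le_add le_rfl h2).trans h3
  have hNm : N ≤ p * m := by
    calc N ≤ j := by rw [hj]; omega
      _ ≤ p * j := Nat.le_mul_of_pos_left j (Fact.out : p.Prime).pos
      _ ≤ p * m := Nat.mul_le_mul_left p (by rw [hm]; omega)
  -- the polynomial identity `Φ_{pm}(P) = (1+X)^N P`
  have hpoly : twistSubst (p * m) P = (1 + X) ^ N * P := by
    apply oneVar_algebraMap_injective k p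
    rw [← oneVar_sigma_algebraMap_mul_pow k p σ₁ hσ P (p * m) hPdeg, ← hfP, map_mul, hf,
      map_pow, oneVar_sigma_u k p σ₁ hσ, map_mul, map_pow, map_add, map_one]
    change (1 + s) ^ (p * m) * ((1 + s) ^ N * f * (u * w ^ p) ^ m) = (1 + s) ^ N * _
    -- `(1+s)^{pm} ((1+s)^N f (u w^p)^m) = (1+s)^N (f u^m)`
    have hwp : (1 + s) ^ (p * m) * (w ^ p) ^ m = 1 := by
      rw [← pow_mul, ← mul_pow, mul_comm (1 + s) w, hws, one_pow]
    calc (1 + s) ^ (p * m) * ((1 + s) ^ N * f * (u * w ^ p) ^ m)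
        = (1 + s) ^ N * (f * u ^ m) * ((1 + s) ^ (p * m) * (w ^ p) ^ m) := by rw [mul_pow]; ring
      _ = (1 + s) ^ N * (f * u ^ m) := by rw [hwp, mul_one]
      _ = (1 + s) ^ N * (algebraMap k[X] (OneVarRing k p)) P := by rw [hfP]
  obtain ⟨D, q, hD, hPnf⟩ := exists_normalForm_of_twistSubst_eq p P m N hPdeg hNm hpoly
  have hDm : D ≤ m := Nat.le_of_mul_le_mul_left (le_trans (Nat.le_add_left _ _) hD) (Fact.out : p.Prime).pos
  refine ⟨m, D, q, hD, hDm, ?_⟩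
  -- `f = P(s) v^m`
  have hfv : f = algebraMap k[X] (OneVarRing k p) P * v ^ m := by
    rw [← hfP, mul_assoc, ← mul_pow, huv, one_pow, mul_one]
  rw [hfv, hPnf, map_sum, Finset.sum_mul]
  refine Finset.sum_congr rfl fun d hd => ?_
  have hd' : d ≤ D := Nat.lt_succ_iff.mp (Finset.mem_range.mp hd)
  have hdm : d ≤ m := hd'.trans hDm
  rw [map_mul, map_mul, map_pow, map_pow, hualg, oneVar_algebraMap_C, Algebra.smul_def]
  change (algebraMap k (OneVarRing k p)) (q d) * s ^ (p * m - N - p * d) * u ^ d * v ^ m = _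
  -- `u^d v^m = v^{m-d}`
  have huvd : u ^ d * v ^ m = v ^ (m - d) := by
    have : m = d + (m - d) := by omega
    rw [this, pow_add, ← mul_assoc, ← mul_pow, huv, one_pow, one_mul, Nat.add_sub_cancel_left]
  calc (algebraMap k (OneVarRing k p)) (q d) * s ^ (p * m - N - p * d) * u ^ d * v ^ m
      = (algebraMap k (OneVarRing k p)) (q d) * (s ^ (p * m - N - p * d) * (u ^ d * v ^ m)) := by ring
    _ = _ := by rw [huvd]

/-- **The one-variable lemma, two-sided form** (design (7.7), the graded piece of CLAIM P): if
`(1+s)^a · σ₁ f = (1+s)^b · f` then `f` lies in the `k`-span of the elements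
`s^{pd+a−b} · u^{−d}`, `d ∈ ℤ`, `b ≤ pd + a` (`u^{−d}` as a power of the unit `u`).
Reduction to `oneVar_exists_sum_of_twist` by `f ↦ v^a f` (`σ₁ v = v (1+s)^p`). [OURS · L1 W4.5c] -/
theorem oneVar_mem_span_of_twist (a b : ℕ) (f : OneVarRing k p)
    (hf : (1 + oneVarS k p) ^ a * σ₁ f = (1 + oneVarS k p) ^ b * f) :
    f ∈ Submodule.span k (Set.range fun d : {d : ℤ // (b : ℤ) ≤ (p : ℤ) * d + a} =>
      oneVarS k p ^ ((p : ℤ) * d.1 + a - b).toNat *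
        (((oneVar_isUnit_u k p).unit ^ (-d.1) : (OneVarRing k p)ˣ) : OneVarRing k p)) := by
  classical
  set s := oneVarS k p with hs
  set U : (OneVarRing k p)ˣ := (oneVar_isUnit_u k p).unit with hU
  have hUval : (U : OneVarRing k p) = 1 - oneVarS k p ^ (p - 1) := rfl
  set u := 1 - oneVarS k p ^ (p - 1) with hu
  set v := (↑(U⁻¹) : OneVarRing k p) with hv
  set w := (↑((oneVar_isUnit_one_add_s k p).unit⁻¹) : OneVarRing k p) with hw
  have huv : u * v = 1 := (oneVar_isUnit_u k p).mul_val_inv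
  have hws : w * (1 + s) = 1 := (oneVar_isUnit_one_add_s k p).val_inv_mul
  have hσv : σ₁ v = v * (1 + s) ^ p := oneVar_sigma_v k p σ₁ hσ
  -- `f₁ := v^a f` is twisted with `N₁ = p a − a + b = (p−1)a + b ≥ 0`... use `j := a`
  set j := a with hj
  set N₁ := p * j - a + b with hN₁
  have hpj : a ≤ p * j := by rw [hj]; exact Nat.le_mul_of_pos_left a (Fact.out : p.Prime).pos
  set f₁ := v ^ j * f with hf₁
  have hσf : σ₁ f = w ^ a * ((1 + s) ^ b * f) := by
    have : w ^ a * ((1 + s) ^ a * σ₁ f) = σ₁ f := by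
      rw [← mul_assoc, ← mul_pow, hws, one_pow, one_mul]
    rw [← this, hf]
  have hf₁t : σ₁ f₁ = (1 + s) ^ N₁ * f₁ := by
    rw [hf₁, map_mul, map_pow, hσv, hσf, mul_pow]
    -- `(1+s)^{pj} w^a = (1+s)^{pj - a}`
    have hsplit : p * j = (p * j - a) + a := (Nat.sub_add_cancel hpj).symm
    have h1 : ((1 + s) ^ p) ^ j * w ^ a = (1 + s) ^ (p * j - a) := by
      rw [← pow_mul, hsplit, pow_add, Nat.add_sub_cancel, mul_assoc, ← mul_pow, mul_comm (1 + s) w,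
        hws, one_pow, mul_one]
    calc v ^ j * ((1 + s) ^ p) ^ j * (w ^ a * ((1 + s) ^ b * f))
        = (((1 + s) ^ p) ^ j * w ^ a) * (1 + s) ^ b * (v ^ j * f) := by ring
      _ = (1 + s) ^ (p * j - a) * (1 + s) ^ b * (v ^ j * f) := by rw [h1]
      _ = (1 + s) ^ N₁ * (v ^ j * f) := by rw [hN₁, pow_add]
  obtain ⟨m, D, q, hD, hDm, hsum⟩ := oneVar_exists_sum_of_twist k p σ₁ hσ N₁ f₁ hf₁t
  -- `f = u^j f₁`
  have hfu : f = u ^ j * f₁ := by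
    rw [hf₁, ← mul_assoc, ← mul_pow, huv, one_pow, one_mul]
  rw [hfu, hsum, Finset.mul_sum]
  refine Submodule.sum_mem _ fun d hd => ?_
  have hd' : d ≤ D := Nat.lt_succ_iff.mp (Finset.mem_range.mp hd)
  have hdm : d ≤ m := hd'.trans hDm
  have hbound : N₁ + p * d ≤ p * m := le_trans (by gcongr) hD
  rw [mul_smul_comm]
  refine Submodule.smul_mem _ _ (Submodule.subset_span ?_)
  -- the index `d'' := (m - d) - j`
  have hcond : (b : ℤ) ≤ (p : ℤ) * (((m : ℤ) - d) - j) + a := by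
    have h1 : (N₁ : ℤ) + p * d ≤ p * m := by exact_mod_cast hbound
    have h2 : (N₁ : ℤ) = p * j - a + b := by
      rw [hN₁]; push_cast [Nat.cast_sub hpj]; ring
    nlinarith [h1, h2]
  refine ⟨⟨((m : ℤ) - d) - j, hcond⟩, ?_⟩
  simp only
  -- exponent of `s`
  have hexp : ((p : ℤ) * (((m : ℤ) - d) - j) + a - b).toNat = p * m - N₁ - p * d := by
    have h2 : (N₁ : ℤ) = p * j - a + b := by
      rw [hN₁]; push_cast [Nat.cast_sub hpj]; ring
    have h3 : ((p * m - N₁ - p * d : ℕ) : ℤ) = (p : ℤ) * m - N₁ - p * d := by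
      have : N₁ + p * d ≤ p * m := hbound
      push_cast [Nat.cast_sub (by omega : p * d ≤ p * m - N₁), Nat.cast_sub (by omega : N₁ ≤ p * m)]
      ring
    have h4 : (p : ℤ) * (((m : ℤ) - d) - j) + a - b = ((p * m - N₁ - p * d : ℕ) : ℤ) := by
      rw [h3, h2]; ring
    rw [h4, Int.toNat_natCast]
  -- the unit power: `U^{-((m-d)-j)} = u^j * v^{m-d}`
  have hunit : ((U ^ (-(((m : ℤ) - d) - j)) : (OneVarRing k p)ˣ) : OneVarRing k p) =
      u ^ j * v ^ (m - d) := by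
    have hz : -(((m : ℤ) - d) - j) = (j : ℤ) - ((m - d : ℕ) : ℤ) := by
      push_cast [Nat.cast_sub hdm]; ring
    rw [hz, zpow_sub, zpow_natCast, zpow_natCast, ← inv_pow, Units.val_mul,
      Units.val_pow_eq_pow_val, Units.val_pow_eq_pow_val, hUval]
  rw [hexp, hunit]
  ring

end Law

end Summit.ResolutionOfSingularities.ResolutionOfSingularities.Theorems.WildQuotientResolution.ConductorOne

end
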